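import Summits.BirchSwinnertonDyer.BirchSwinnertonDyer.Theorems.GoldfeldAllTwistsTwoConverseTwinGenusDescentTorsion
import Literature.NumberTheory.EllipticCurves.KrizLi2019.SexticTwistBSDThreeDescent
import Literature.NumberTheory.EllipticCurves.LeadingTermRegulatorProofs
import Literature.NumberTheory.EllipticCurves.MordellWeilTheoremProofs
import HarnessLib

set_option linter.dupNamespace false -- `…BirchSwinnertonDyer.BirchSwinnertonDyer…` is the cell's namespace (D-0017)
set_option autoImplicit false

/-!
# LINE B49 — the FIXED partner curves, VI: the ODD INDEX of `g₇₈₄ = (8, 8)` in `W₇₈₄(ℚ)` in the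
# requested uniform form, the regulator, and «BSD₂(784) exact» modulo the Tamagawa product

Cell `bsd-goldfeld`, seat `bsd-goldfeld-s1p-c301` (prover, gen 6); TARGET v5.5 §2 c301 (g) (planner g16
ruling (xxxvii): seat c3's REQUESTED odd-index form + W-A5 of `GENUS-THEOREM-A.md`); support for item
`stmt-BirchSwinnertonDyer-19140` (twin″; joint with 20044). HONEST FRAMING: theorems about the explicit
curve `W₇₈₄ = [0, −21, 0, 112, 0]` (global minimal model of `49a1^{(−1)}`, files I/III/V); the last
theorem takes bsd.S31, Modularity and the Tamagawa value `∏ c_p(W₇₈₄) = 8` (Cremona's table: `c₂ = 4`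
(`I₄*`), `c₇ = 2` (`III`); NOT yet a kernel theorem — the tree's `Iₙ*` index fact only gives
`c₂ ∈ {2, 4}`) as NAMED binders; BSD is not proved by any of this. Not in the Theses cone.
§1 Mordell–Weil bases of a rank-one curve reindexed to `Fin 1` and the UNIFORM odd index
(`exists_odd_forall_exists_zsmul_sub_zsmul`: ONE odd `n` with `n • P − a • g ∈ tors` for every `P`);
§2 on `W₇₈₄` with `g₇₈₄ = (8, 8)` (seat c3's currency; `α(g₇₈₄) = [2] ∉ {1, [7]}` directly on the model):
`eightEight_ne_two_zsmul_add_W784`, `exists_isMordellWeilBasis_fin_one_W784`,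
`exists_odd_eightEight_sub_zsmul_basis_W784`, **`exists_odd_forall_exists_zsmul_sub_zsmul_eightEight_W784`**
(the requested «∃ n, Odd n ∧ ∀ P, ∃ a, IsOfFinAddOrder (n • P − a • g₇₈₄)»),
`regulator_W784_eq_canonicalHeight` (`Reg = ĥ(P₀)`), `exists_odd_canonicalHeight_eightEight_W784`
(`ĥ(g₇₈₄) = k²·Reg`, `k` odd), **`leadingLCoeff_W784_of_tamagawaProduct`**: `L⁽¹⁾(W₇₈₄, 1) =
r · Ω(W₇₈₄) · ĥ(g₇₈₄)` with `r = 2·#Ш/k² ∈ ℚ`, `v₂(r) = 1` (W-A5 «BSD₂(784) exact», modulo `∏c_p = 8`).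
References: [SilvermanAEC2009] VIII.6.7, VIII.9.3; [SilvermanTate2015] §3.5; [CreutzMiller2012];
[CremonaAlgorithms1997] Table 1 (784).
-/

noncomputable section

open scoped Classical

open WeierstrassCurve Literature.NumberTheory.EllipticCurves Literature.NumberTheory.EllipticCurves.ModularForms

namespace Summit.BirchSwinnertonDyer.BirchSwinnertonDyer.Theorems.GoldfeldGoodTwists

/-! ## §1 Mordell–Weil bases of a rank-one curve, reindexed to `Fin 1` -/

/-- Reindexing a Mordell–Weil basis along an equivalence of index types. [folklore] -/
theorem isMordellWeilBasis_comp_equiv {K : Type*} [Field K] {W : WeierstrassCurve K} {ι ι' : Type*}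
    {P : ι → W.toAffine.Point} (hP : IsMordellWeilBasis P) (e : ι' ≃ ι) :
    IsMordellWeilBasis (P ∘ e) := by
  refine ⟨?_, ?_⟩
  · have : (QuotientAddGroup.mk ∘ (P ∘ e) : ι' → mordellWeilModTorsion W) =
        (QuotientAddGroup.mk ∘ P) ∘ e := rfl
    rw [this]
    exact hP.1.comp e e.injective
  · have : (QuotientAddGroup.mk ∘ (P ∘ e) : ι' → mordellWeilModTorsion W) =
        (QuotientAddGroup.mk ∘ P) ∘ e := rfl
    rw [this, e.surjective.range_comp]
    exact hP.2

/-- **A rank-one elliptic curve over `ℚ` has a Mordell–Weil basis indexed by `Fin 1`** (Mordell–Weil,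
tree `exists_isMordellWeilBasis_holds`, reindexed along `rank = 1`). [cite: SilvermanAEC2009, Thm. VIII.6.7] -/
theorem exists_isMordellWeilBasis_fin_one (W : WeierstrassCurve ℚ) [W.IsElliptic]
    (hr : W.mordellWeilRank = 1) : ∃ P : Fin 1 → W.toAffine.Point, IsMordellWeilBasis P := by
  obtain ⟨P, hP⟩ := W.exists_isMordellWeilBasis_holds
  exact ⟨P ∘ (finCongr hr.symm), isMordellWeilBasis_comp_equiv hP _⟩

/-- **Uniform odd index.** In rank one, a non-halvable point `g` (i.e. `g ∉ 2E(ℚ) + tors`) satisfies: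
there is ONE odd `n` (its coordinate along a Mordell–Weil basis) such that every `P ∈ E(ℚ)` has
`n • P − a • g ∈ E(ℚ)_tors` for some `a`. [cite: SilvermanAEC2009, Ch. VIII intro (p. 207)] -/
theorem exists_odd_forall_exists_zsmul_sub_zsmul {K : Type*} [Field K] {W : WeierstrassCurve K}
    {P : Fin 1 → W.toAffine.Point} (hP : IsMordellWeilBasis P) {g : W.toAffine.Point}
    (hg2 : ∀ R t : W.toAffine.Point, IsOfFinAddOrder t → g ≠ (2 : ℤ) • R + t) :
    ∃ n : ℤ, Odd n ∧ ∀ Q : W.toAffine.Point, ∃ a : ℤ, IsOfFinAddOrder (n • Q - a • g) := by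
  obtain ⟨k, hk⟩ := exists_sub_zsmul_isOfFinAddOrder_of_isMordellWeilBasis hP g
  refine ⟨k, odd_of_sub_zsmul_isOfFinAddOrder hg2 hk, fun Q => ?_⟩
  obtain ⟨a, ha⟩ := exists_sub_zsmul_isOfFinAddOrder_of_isMordellWeilBasis hP Q
  refine ⟨a, ?_⟩
  have e : k • Q - a • g = k • (Q - a • P 0) - a • (g - k • P 0) := by module
  rw [e, ← AddCommGroup.mem_torsion]
  exact sub_mem (AddSubgroup.zsmul_mem _ ((AddCommGroup.mem_torsion _).mpr ha) k)
    (AddSubgroup.zsmul_mem _ ((AddCommGroup.mem_torsion _).mpr hk) a)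

/-! ## §2 `W₇₈₄ = [0, −21, 0, 112, 0]` and `g₇₈₄ = (8, 8)` (seat c3's requested currency) -/

section W784

/-- `g₇₈₄ = (8, 8)` lies on `W₇₈₄ : y² = x³ − 21x² + 112x` (`512 − 1344 + 896 = 64`); it is the image
of `(0, 1) ∈ cm7^{(−1)}` under `(1/2, −2, 0, 0)` and of `(0, i) ∈ X₀(49)(ℚ(i))` under the twist
substitution. [folklore] -/
theorem nonsingular_W784_eight_eight : (⟨0, -21, 0, 112, 0⟩ : WeierstrassCurve ℚ).toAffine.Nonsingular 8 8 := by
  haveI := isElliptic_twoTorsionModel_neg_one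
  refine (Affine.equation_iff_nonsingular).mp ?_
  rw [Affine.equation_iff']
  norm_num

/-- **`g₇₈₄ = (8, 8) ∉ 2W₇₈₄(ℚ) + W₇₈₄(ℚ)_tors`** (`α(g₇₈₄) = [8] = [2] ∉ {1, [112] = [7]}`, `a² − 4b = −7`).
[cite: SilvermanTate2015, §3.5] -/
theorem eightEight_ne_two_zsmul_add_W784
    (R t : (⟨0, -21, 0, 112, 0⟩ : WeierstrassCurve ℚ).toAffine.Point) (ht : IsOfFinAddOrder t) :
    Affine.Point.some 8 8 nonsingular_W784_eight_eight ≠ (2 : ℤ) • R + t := by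
  haveI := isElliptic_twoTorsionModel_neg_one
  obtain ⟨h7, h7', h2, h14⟩ := not_isSquare_rat_neg7_7_2_14
  have hD : ¬ IsSquare ((⟨0, -21, 0, 112, 0⟩ : WeierstrassCurve ℚ).a₂ ^ 2 -
      4 * (⟨0, -21, 0, 112, 0⟩ : WeierstrassCurve ℚ).a₄) := by
    rw [show ((⟨0, -21, 0, 112, 0⟩ : WeierstrassCurve ℚ).a₂ ^ 2 -
      4 * (⟨0, -21, 0, 112, 0⟩ : WeierstrassCurve ℚ).a₄) = -7 by norm_num]; exact h7
  have hb : ¬ IsSquare (⟨0, -21, 0, 112, 0⟩ : WeierstrassCurve ℚ).a₄ := by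
    rw [show (⟨0, -21, 0, 112, 0⟩ : WeierstrassCurve ℚ).a₄ = 112 by rfl]; rintro ⟨r, hr⟩
    exact h7' (isSquare_of_sq_mul (k := 4) (by norm_num) (by linear_combination hr.symm))
  have h8 : ¬ IsSquare (8 : ℚ) := by
    rintro ⟨r, hr⟩; exact h2 (isSquare_of_sq_mul (k := 2) (by norm_num) (by linear_combination hr.symm))
  have h896 : ¬ IsSquare ((8 : ℚ) * (⟨0, -21, 0, 112, 0⟩ : WeierstrassCurve ℚ).a₄) := by
    rw [show (⟨0, -21, 0, 112, 0⟩ : WeierstrassCurve ℚ).a₄ = 112 by rfl]; rintro ⟨r, hr⟩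
    exact h14 (isSquare_of_sq_mul (k := 8) (by norm_num) (by linear_combination hr.symm))
  have h := some_ne_two_zsmul_add_of_not_isSquare (⟨0, -21, 0, 112, 0⟩ : WeierstrassCurve ℚ) hD hb
    nonsingular_W784_eight_eight (by norm_num) h8 h896 R t (by convert ht)
  convert h

/-- **`g₇₈₄` has infinite order.** [cite: SilvermanTate2015, §3.5] -/
theorem not_isOfFinAddOrder_eightEight_W784 :
    ¬ IsOfFinAddOrder (Affine.Point.some 8 8 nonsingular_W784_eight_eight :
      (⟨0, -21, 0, 112, 0⟩ : WeierstrassCurve ℚ).toAffine.Point) := fun hfin =>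
  eightEight_ne_two_zsmul_add_W784 0 _ hfin (by rw [zsmul_zero, zero_add])

/-- `W₇₈₄(ℚ)` has a Mordell–Weil basis with ONE element (rank one, file III).
[cite: SilvermanAEC2009, Thm. VIII.6.7] -/
theorem exists_isMordellWeilBasis_fin_one_W784 :
    ∃ P : Fin 1 → (⟨0, -21, 0, 112, 0⟩ : WeierstrassCurve ℚ).toAffine.Point, IsMordellWeilBasis P := by
  haveI := isElliptic_twoTorsionModel_neg_one
  exact exists_isMordellWeilBasis_fin_one _ rank_and_sha_two_twoTorsionModel_neg_one.1

/-- **Along any Mordell–Weil basis `P₀` of `W₇₈₄(ℚ)`: `g₇₈₄ ≡ k • P₀ (mod tors)` with `k` ODD.**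
[cite: SilvermanAEC2009, Ch. VIII intro (p. 207)] [cite: SilvermanTate2015, §3.5] -/
theorem exists_odd_eightEight_sub_zsmul_basis_W784
    {P : Fin 1 → (⟨0, -21, 0, 112, 0⟩ : WeierstrassCurve ℚ).toAffine.Point} (hP : IsMordellWeilBasis P) :
    ∃ k : ℤ, Odd k ∧ IsOfFinAddOrder (Affine.Point.some 8 8 nonsingular_W784_eight_eight - k • P 0) := by
  obtain ⟨a, ha⟩ := exists_sub_zsmul_isOfFinAddOrder_of_isMordellWeilBasis hP
    (Affine.Point.some 8 8 nonsingular_W784_eight_eight)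
  have ha' : IsOfFinAddOrder (Affine.Point.some 8 8 nonsingular_W784_eight_eight - a • P 0) := by
    convert ha
  exact ⟨a, odd_of_sub_zsmul_isOfFinAddOrder eightEight_ne_two_zsmul_add_W784 ha', ha'⟩

/-- **The requested uniform ODD-INDEX form (seat c3, TARGET v5.5 §2 c301 (g)): there is an odd `n`
such that every `P ∈ W₇₈₄(ℚ)` satisfies `n • P − a • g₇₈₄ ∈ W₇₈₄(ℚ)_tors` for some `a`.**
[cite: SilvermanAEC2009, Ch. VIII intro (p. 207)] [cite: SilvermanTate2015, §3.5] -/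
theorem exists_odd_forall_exists_zsmul_sub_zsmul_eightEight_W784 :
    ∃ n : ℤ, Odd n ∧ ∀ P : (⟨0, -21, 0, 112, 0⟩ : WeierstrassCurve ℚ).toAffine.Point,
      ∃ a : ℤ, IsOfFinAddOrder (n • P - a • Affine.Point.some 8 8 nonsingular_W784_eight_eight) := by
  obtain ⟨P₀, hP₀⟩ := exists_isMordellWeilBasis_fin_one_W784
  obtain ⟨n, hn, h⟩ := exists_odd_forall_exists_zsmul_sub_zsmul hP₀
    (g := Affine.Point.some 8 8 nonsingular_W784_eight_eight)
    (fun R t ht => eightEight_ne_two_zsmul_add_W784 R t (by convert ht) ∘ fun e => by convert e)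
  refine ⟨n, hn, fun P => ?_⟩
  obtain ⟨a, ha⟩ := h P
  exact ⟨a, by convert ha⟩

/-! ### The regulator and «BSD₂(784) exact» modulo the Tamagawa product -/

/-- **`Reg(W₇₈₄/ℚ) = ĥ(P₀)`** for any Mordell–Weil basis `P₀` (one element; tree `regulator_eq_det_holds`
and `⟨P, P⟩ = ĥ(P)`). [cite: SilvermanAEC2009, VIII.9] -/
theorem regulator_W784_eq_canonicalHeight
    {P : Fin 1 → (⟨0, -21, 0, 112, 0⟩ : WeierstrassCurve ℚ).toAffine.Point} (hP : IsMordellWeilBasis P) :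
    (⟨0, -21, 0, 112, 0⟩ : WeierstrassCurve ℚ).regulator = (P 0).canonicalHeight := by
  haveI := isElliptic_twoTorsionModel_neg_one
  have h := regulator_eq_det_holds (⟨0, -21, 0, 112, 0⟩ : WeierstrassCurve ℚ) P (by convert hP)
  rw [h, Matrix.det_fin_one, Matrix.of_apply]
  exact Affine.Point.heightPairing_self_holds (P 0)

/-- **`ĥ(g₇₈₄) = k² · Reg(W₇₈₄/ℚ)` with `k` ODD** (`g₇₈₄ ≡ k • P₀`, quadraticity and torsion-invariance of
`ĥ`). [cite: SilvermanAEC2009, Thm. VIII.9.3] -/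
theorem exists_odd_canonicalHeight_eightEight_W784 :
    ∃ k : ℤ, Odd k ∧ (Affine.Point.some 8 8 nonsingular_W784_eight_eight :
      (⟨0, -21, 0, 112, 0⟩ : WeierstrassCurve ℚ).toAffine.Point).canonicalHeight =
        (k : ℝ) ^ 2 * (⟨0, -21, 0, 112, 0⟩ : WeierstrassCurve ℚ).regulator := by
  haveI := isElliptic_twoTorsionModel_neg_one
  obtain ⟨P₀, hP₀⟩ := exists_isMordellWeilBasis_fin_one_W784
  obtain ⟨k, hk, ht⟩ := exists_odd_eightEight_sub_zsmul_basis_W784 hP₀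
  refine ⟨k, hk, ?_⟩
  rw [regulator_W784_eq_canonicalHeight hP₀]
  refine KrizLi2019.canonicalHeight_eq_of_sub_zsmul_mem_torsion (⟨0, -21, 0, 112, 0⟩ : WeierstrassCurve ℚ) ?_
  have ht' := (AddCommGroup.mem_torsion _).mpr ht
  convert ht'

/-- **«BSD₂(784) EXACT» modulo the Tamagawa product** (W-A5 of the cell's GENUS-THEOREM-A plan): granted
bsd.S31 (`bsdTriple_of_rank_le_one_of_conductor_lt`), Modularity (`exists_isNewformOf`) and the value
`∏ c_p(W₇₈₄) = 8` (`c₂ = 4`, type `I₄*`; `c₇ = 2`, type `III`; Cremona's table — NOT yet a kernel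
theorem, taken as the binder `hc`), the leading term of `W₇₈₄ = [0, −21, 0, 112, 0]` satisfies
`L′(W₇₈₄, 1) = r · Ω(W₇₈₄) · ĥ(g₇₈₄)` with `r = 2·#Ш/k² ∈ ℚ`, `v₂(r) = 1` — from LEAD,
`Reg = ĥ(P₀) = ĥ(g₇₈₄)/k²` (`k` odd, kernel), `#E(ℚ)_tors = 2` (kernel, file V) and `#Ш` odd (kernel
`Ш[2] = 0` + S31 finiteness, file III). [cite: CreutzMiller2012, Thm 1.1 and the remark following it]
[cite: CremonaAlgorithms1997, Table 1 (curve 784)] -/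
theorem leadingLCoeff_W784_of_tamagawaProduct (hS31 : bsdTriple_of_rank_le_one_of_conductor_lt)
    (hmod : exists_isNewformOf) (hc : (⟨0, -21, 0, 112, 0⟩ : WeierstrassCurve ℚ).tamagawaProduct = 8) :
    ∃ r : ℚ, padicValRat 2 r = 1 ∧
      (⟨0, -21, 0, 112, 0⟩ : WeierstrassCurve ℚ).leadingLCoeff =
        ((r : ℝ) * (⟨0, -21, 0, 112, 0⟩ : WeierstrassCurve ℚ).realPeriodRat *
          (Affine.Point.some 8 8 nonsingular_W784_eight_eight :
            (⟨0, -21, 0, 112, 0⟩ : WeierstrassCurve ℚ).toAffine.Point).canonicalHeight : ℝ) := by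
  haveI := isElliptic_twoTorsionModel_neg_one
  obtain ⟨-, -, hodd, hlead⟩ := analyticRank_shaFinite_odd_twoTorsionModel_neg_one hS31 hmod
  obtain ⟨k, hk, hheight⟩ := exists_odd_canonicalHeight_eightEight_W784
  have htors := torsion_twoTorsionModel_neg_one.2
  have hkne : k ≠ 0 := fun h => by simp [h] at hk
  set S := (⟨0, -21, 0, 112, 0⟩ : WeierstrassCurve ℚ).shaOrder with hS
  refine ⟨2 * (S : ℚ) / (k : ℚ) ^ 2, ?_, ?_⟩
  · -- `v₂(2 S / k²) = 1`
    have hS0 : (S : ℚ) ≠ 0 := by exact_mod_cast hodd.pos.ne'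
    have hkq : (k : ℚ) ≠ 0 := by exact_mod_cast hkne
    haveI : Fact (Nat.Prime 2) := ⟨Nat.prime_two⟩
    have h22 : padicValRat 2 (2 : ℚ) = 1 := by simpa using padicValRat.self (p := 2) one_lt_two
    have h1 : padicValNat 2 S = 0 := padicValNat.eq_zero_of_not_dvd (fun h =>
      (Nat.not_even_iff_odd.mpr hodd) (even_iff_two_dvd.mpr h))
    have h2 : padicValInt 2 k = 0 := by
      rw [padicValInt, padicValNat.eq_zero_of_not_dvd (fun h => ?_)]
      exact (Int.not_even_iff_odd.mpr hk)
        (even_iff_two_dvd.mpr (Int.natAbs_dvd_natAbs.mp (by simpa using h)))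
    rw [padicValRat.div (mul_ne_zero two_ne_zero hS0) (pow_ne_zero 2 hkq),
      padicValRat.mul two_ne_zero hS0, padicValRat.pow, h22, padicValRat.of_nat, padicValRat.of_int,
      h1, h2]
    norm_num
  · have hkR : (k : ℝ) ≠ 0 := by exact_mod_cast hkne
    have hreal : (⟨0, -21, 0, 112, 0⟩ : WeierstrassCurve ℚ).bsdRHS =
        ((2 * (S : ℚ) / (k : ℚ) ^ 2 : ℚ) : ℝ) * (⟨0, -21, 0, 112, 0⟩ : WeierstrassCurve ℚ).realPeriodRat *
          (Affine.Point.some 8 8 nonsingular_W784_eight_eight :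
            (⟨0, -21, 0, 112, 0⟩ : WeierstrassCurve ℚ).toAffine.Point).canonicalHeight := by
      rw [bsdRHS_def, hc, htors, hheight]
      push_cast
      field_simp
      ring
    rw [hlead, hreal]

end W784

end Summit.BirchSwinnertonDyer.BirchSwinnertonDyer.Theorems.GoldfeldGoodTwists

end
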